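import Literature.NumberTheory.GaloisCohomology.ShaRestrictedShapiroLayerChange
import Literature.NumberTheory.GaloisCohomology.ShaRestrictedShapiroLayerConj
import Literature.NumberTheory.GaloisRepresentations.RestrictedCohomologyFunctoriality
import HarnessLib

/-!
# `Шⁿ_S` of the layers is FUNCTORIAL: restriction to a smaller layer, corestriction to a bigger one, change of
# coefficients and conjugation preserve `layerShaRestricted` (degrees `1`, `2`)

Topic `NumberTheory/GaloisCohomology`; namespace `Literature.NumberTheory.GaloisCohomology.ShaLayer` (continues the series
`ShaRestrictedLayerTransport` / `ShaRestrictedShapiroLayer` / `…LayerChange` / `…LayerConj` of seats `bsd-line-cf2c-w3` g9–g10).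
Cell `bsd-print-cf2` (`run/shared/lean/pub/bsd-print-cf2/`), width seat `bsd-line-cf2c-w8` g8 (prover): the stability fields
`sha_cores / sha_red / sha_conj` and the maps `resY / inclY / conjY` of the ROW 1 socket `JohnsonLeungKings2011.LayerDuality`
(`…/EllipticUnits/ImaginaryQuadraticMainConjectureClassGroupRow.lean`). THEOREMS ONLY; no definition, no named fact, no
instance, no `sorry`.

WHAT. For an open normal `N ⊴ Γ_K` containing `N_S` (a layer `L = K̄^N ⊂ K_S`) the tree's `layerShaRestricted S ρ N n ≤
Hⁿ(N̄, M^{N_S})` is `Шⁿ_S(L, M)` (classes locally trivial at every place above `S ∪ ∞`), identified with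
`Шⁿ_S(K, Ind_N^{Γ_K} M) = shaRestricted (ρ.coindOpen N hN) S n` by the Ш-condition transport `shaRestrictedLayerEquiv` (file
4). Since the maps `Hⁿ(G_S, F)` of EQUIVARIANT coefficient maps `F` preserve `shaRestricted` (tree
`DiscreteGaloisModule.map_mem_shaRestricted`), and the dictionary of files 5–6 identifies `Hⁿ(G_S, pull-back / fibre sum /
Maps(F))` with restriction / relative corestriction / `Hⁿ(N̄, F^{N_S})` of the layer groups, the latter preserve `Шⁿ_S`:

* `resLe_mem_layerShaRestricted_one/_two` — restriction `Hⁿ(N̄, ·) → Hⁿ(N̄′, ·)` for `N′ ≤ N` (`L′ ⊇ L`);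
* `relCor_mem_layerShaRestricted_one/_two` — relative corestriction `Hⁿ(N̄′, ·) → Hⁿ(N̄, ·)` (`cor_{L′/L}`);
* `cohomologyMap_mem_layerShaRestricted_one/_two` — `Hⁿ(N̄, F^{N_S})` for `F : M → M′` equivariant;
* `conjMap_mem_layerShaRestricted` — conjugation by `σ̄ ∈ G_S`, every degree (directly from the definition: the family of
  local conditions is `G_S`-stable, `conjMap_conjMap`).

HONEST FRAMING: bookkeeping; no duality, no main conjecture, no BSD is proved here; no summit statement is proved by this seat.

## References
* J. S. Milne, *Arithmetic Duality Theorems*, 2nd ed. (2006), I §4 (pp. 55–57). [MilneADT2006]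
* J. Neukirch, A. Schmidt, K. Wingberg, *Cohomology of Number Fields* (2008), I §5 (1.5.3)–(1.5.7), I §6 (1.6.4)–(1.6.5).
  [NeukirchSchmidtWingberg2008]
* J.-P. Serre, *Local Fields* (1979), VII §5; *Galois Cohomology* (1997), I §2.5. [SerreLocalFields1979] [SerreGaloisCohomology1997]
-/

noncomputable section

open CategoryTheory Function NumberField Field IsDedekindDomain
open scoped NumberField

namespace Literature.NumberTheory.GaloisCohomology

open Literature.NumberTheory.GaloisRepresentations
open Literature.NumberTheory.GaloisRepresentations.DiscreteGaloisModule (restrictedCohomology shaRestricted quotientInvariants)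
open _root_.TopRep

namespace ShaLayer

variable {K : Type} [Field K] [NumberField K] (S : Set (HeightOneSpectrum (𝓞 K)))
variable {M : Type} [AddCommGroup M] [TopologicalSpace M] [DiscreteTopology M] (ρ : DiscreteGaloisModule K M)
variable {M' : Type} [AddCommGroup M'] [TopologicalSpace M'] [DiscreteTopology M'] (ρ' : DiscreteGaloisModule K M')
variable (N N' : Subgroup (absoluteGaloisGroup K)) [N.Normal] [N'.Normal]

/-! ## §1 Conjugation -/

/-- **`Шⁿ_S` of the layer is stable under conjugation** by every `σ̄ ∈ G_S` (the local conditions at the places above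
`S ∪ ∞` form a `G_S`-stable family; `conjMap_conjMap`). [cite: MilneADT2006, I §4 (p. 56)] [cite: SerreLocalFields1979, VII §5] -/
theorem conjMap_mem_layerShaRestricted (σ : GaloisGroupUnramifiedOutside K S) (n : ℕ)
    {z : continuousCohomology n (subgroupRep (ρ.quotientInvariants (ramificationSubgroup K S)).toTopRep
        (N.map (toUnramifiedQuot K S)))}
    (hz : z ∈ layerShaRestricted S ρ N n) :
    (conjMap (ρ.quotientInvariants (ramificationSubgroup K S)).toTopRep (N.map (toUnramifiedQuot K S)) σ n).hom z ∈
      layerShaRestricted S ρ N n := by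
  rw [mem_layerShaRestricted_iff] at hz ⊢
  have hc : ∀ τ : GaloisGroupUnramifiedOutside K S,
      layerConj S ρ N τ n ((conjMap (ρ.quotientInvariants (ramificationSubgroup K S)).toTopRep
        (N.map (toUnramifiedQuot K S)) σ n).hom z) = layerConj S ρ N (τ * σ) n z := fun τ => by
    rw [layerConj_apply, layerConj_apply]
    exact conjMap_conjMap _ _ σ τ n z
  exact ⟨fun w τ => by rw [hc]; exact hz.1 w _, fun v hv τ => by rw [hc]; exact hz.2 v hv _⟩

/-! ## §2 Restriction, corestriction, change of coefficients (degrees `1` and `2`) -/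

section Transport

variable [N.FiniteIndex] [N'.FiniteIndex]

/-- **Restriction to a smaller layer preserves `Ш¹_S`**: `res_{N̄′ ≤ N̄} (Ш¹_S(L, M)) ⊆ Ш¹_S(L′, M)` for `N′ ≤ N`
(under the Ш-transport it is `H¹(G_S, ·)` of the equivariant pull-back `Ind_N M → Ind_{N′} M`).
[cite: NeukirchSchmidtWingberg2008, I §5 (1.5.3), I §6 (1.6.4)–(1.6.5)] [cite: MilneADT2006, I §4 (p. 56)] -/
theorem resLe_mem_layerShaRestricted_one (hN : IsOpen (N : Set (absoluteGaloisGroup K))) (hN' : IsOpen (N' : Set (absoluteGaloisGroup K))) (h : N' ≤ N)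
    (hNS : ramificationSubgroup K S ≤ N) (hN'S : ramificationSubgroup K S ≤ N') (hρ : ramificationSubgroup K S ≤ ContinuousRep.ker ρ)
    {z : continuousCohomology 1 (subgroupRep (ρ.quotientInvariants (ramificationSubgroup K S)).toTopRep
        (N.map (toUnramifiedQuot K S)))}
    (hz : z ∈ layerShaRestricted S ρ N 1) :
    (resLe (ρ.quotientInvariants (ramificationSubgroup K S)).toTopRep
        (Subgroup.map_mono h : N'.map (toUnramifiedQuot K S) ≤ N.map (toUnramifiedQuot K S)) 1).hom z ∈
      layerShaRestricted S ρ N' 1 := by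
  set c := (shaRestrictedLayerEquiv_one S ρ N hN hNS hρ).symm ⟨z, hz⟩ with hc
  have hzc : z = layerShapiroEquiv S ρ N hN 1 (restrictedCohomologyEquiv S ρ N hN hNS hρ 1
      (c : restrictedCohomology (ρ.coindOpen N hN) S 1)) := by
    rw [← coe_shaRestrictedLayerEquiv_one, hc, AddEquiv.apply_symm_apply]
  have hmem := DiscreteGaloisModule.map_mem_shaRestricted (ρ := ρ.coindOpen N hN) (ρ' := ρ.coindOpen N' hN')
    (coindFinRes ρ.toTopRep h) S 1 c.2
  have key := layerShapiroEquiv_transport_coindFinRes S ρ N N' hN hN' h hNS hN'S hρ 1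
    (c : restrictedCohomology (ρ.coindOpen N hN) S 1)
  have hval := coe_shaRestrictedLayerEquiv_one S ρ N' hN' hN'S hρ ⟨_, hmem⟩
  rw [hzc]
  change resLe _ _ 1 _ ∈ _
  rw [← key, ← hval]
  exact (shaRestrictedLayerEquiv_one S ρ N' hN' hN'S hρ ⟨_, hmem⟩).2

/-- **Restriction preserves `Ш²_S`** (as `…_one`). [cite: NeukirchSchmidtWingberg2008, I §6 (1.6.4)–(1.6.5)] [cite: MilneADT2006, I §4 (p. 56)] -/
theorem resLe_mem_layerShaRestricted_two (hN : IsOpen (N : Set (absoluteGaloisGroup K))) (hN' : IsOpen (N' : Set (absoluteGaloisGroup K))) (h : N' ≤ N)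
    (hNS : ramificationSubgroup K S ≤ N) (hN'S : ramificationSubgroup K S ≤ N') (hρ : ramificationSubgroup K S ≤ ContinuousRep.ker ρ)
    {z : continuousCohomology 2 (subgroupRep (ρ.quotientInvariants (ramificationSubgroup K S)).toTopRep
        (N.map (toUnramifiedQuot K S)))}
    (hz : z ∈ layerShaRestricted S ρ N 2) :
    (resLe (ρ.quotientInvariants (ramificationSubgroup K S)).toTopRep
        (Subgroup.map_mono h : N'.map (toUnramifiedQuot K S) ≤ N.map (toUnramifiedQuot K S)) 2).hom z ∈
      layerShaRestricted S ρ N' 2 := by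
  set c := (shaRestrictedLayerEquiv_two S ρ N hN hNS hρ).symm ⟨z, hz⟩ with hc
  have hzc : z = layerShapiroEquiv S ρ N hN 2 (restrictedCohomologyEquiv S ρ N hN hNS hρ 2
      (c : restrictedCohomology (ρ.coindOpen N hN) S 2)) := by
    rw [← coe_shaRestrictedLayerEquiv_two, hc, AddEquiv.apply_symm_apply]
  have hmem := DiscreteGaloisModule.map_mem_shaRestricted (ρ := ρ.coindOpen N hN) (ρ' := ρ.coindOpen N' hN')
    (coindFinRes ρ.toTopRep h) S 2 c.2
  have key := layerShapiroEquiv_transport_coindFinRes S ρ N N' hN hN' h hNS hN'S hρ 2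
    (c : restrictedCohomology (ρ.coindOpen N hN) S 2)
  have hval := coe_shaRestrictedLayerEquiv_two S ρ N' hN' hN'S hρ ⟨_, hmem⟩
  rw [hzc]
  change resLe _ _ 2 _ ∈ _
  rw [← key, ← hval]
  exact (shaRestrictedLayerEquiv_two S ρ N' hN' hN'S hρ ⟨_, hmem⟩).2

/-- **Relative corestriction preserves `Ш¹_S`**: `cor_{L′/L} (Ш¹_S(L′, M)) ⊆ Ш¹_S(L, M)` (under the transport: `H¹(G_S, ·)` of
the fibre sum `Ind_{N′} M → Ind_N M`). [cite: NeukirchSchmidtWingberg2008, I §5 (1.5.3), I §6 (1.6.4)–(1.6.5)] [cite: MilneADT2006, I §4 (p. 65)] -/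
theorem relCor_mem_layerShaRestricted_one (hN : IsOpen (N : Set (absoluteGaloisGroup K))) (hN' : IsOpen (N' : Set (absoluteGaloisGroup K))) (h : N' ≤ N)
    (hNS : ramificationSubgroup K S ≤ N) (hN'S : ramificationSubgroup K S ≤ N') (hρ : ramificationSubgroup K S ≤ ContinuousRep.ker ρ) [Fintype (absoluteGaloisGroup K ⧸ N')]
    [Fintype (GaloisGroupUnramifiedOutside K S ⧸ N'.map (toUnramifiedQuot K S))]
    [Fintype (↥(N.map (toUnramifiedQuot K S)) ⧸ (N'.map (toUnramifiedQuot K S)).subgroupOf (N.map (toUnramifiedQuot K S)))]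
    {y : continuousCohomology 1 (subgroupRep (ρ.quotientInvariants (ramificationSubgroup K S)).toTopRep
        (N'.map (toUnramifiedQuot K S)))}
    (hy : y ∈ layerShaRestricted S ρ N' 1) :
    haveI : TotallyDisconnectedSpace (GaloisGroupUnramifiedOutside K S) :=
      Literature.GroupTheory.ProfiniteSubquotients.totallyDisconnectedSpace_quotient
        (ramificationSubgroup K S) (ramificationSubgroup_isClosed K S)
    haveI : IsClosed ((N.map (toUnramifiedQuot K S) : Subgroup (GaloisGroupUnramifiedOutside K S)) :
        Set (GaloisGroupUnramifiedOutside K S)) := Subgroup.isClosed_of_isOpen _ (isOpen_map_toUnramifiedQuot S N hN)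
    haveI : IsClosed ((N'.map (toUnramifiedQuot K S) : Subgroup (GaloisGroupUnramifiedOutside K S)) :
        Set (GaloisGroupUnramifiedOutside K S)) := Subgroup.isClosed_of_isOpen _ (isOpen_map_toUnramifiedQuot S N' hN')
    relCor (N.map (toUnramifiedQuot K S)) (N'.map (toUnramifiedQuot K S)) (ρ.quotientInvariants (ramificationSubgroup K S))
        (Subgroup.map_mono h) 1 y ∈ layerShaRestricted S ρ N 1 := by
  set c := (shaRestrictedLayerEquiv_one S ρ N' hN' hN'S hρ).symm ⟨y, hy⟩ with hc
  have hyc : y = layerShapiroEquiv S ρ N' hN' 1 (restrictedCohomologyEquiv S ρ N' hN' hN'S hρ 1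
      (c : restrictedCohomology (ρ.coindOpen N' hN') S 1)) := by
    rw [← coe_shaRestrictedLayerEquiv_one, hc, AddEquiv.apply_symm_apply]
  have hmem := DiscreteGaloisModule.map_mem_shaRestricted (ρ := ρ.coindOpen N' hN') (ρ' := ρ.coindOpen N hN)
    (coindFinSum ρ.toTopRep h) S 1 c.2
  have key := layerShapiroEquiv_transport_coindFinSum S ρ N N' hN hN' h hNS hN'S hρ 1
    (c : restrictedCohomology (ρ.coindOpen N' hN') S 1)
  have hval := coe_shaRestrictedLayerEquiv_one S ρ N hN hNS hρ ⟨_, hmem⟩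
  rw [hyc, ← key, ← hval]
  exact (shaRestrictedLayerEquiv_one S ρ N hN hNS hρ ⟨_, hmem⟩).2

/-- **Relative corestriction preserves `Ш²_S`** (as `…_one`). [cite: NeukirchSchmidtWingberg2008, I §6 (1.6.4)–(1.6.5)] [cite: MilneADT2006, I §4 (p. 65)] -/
theorem relCor_mem_layerShaRestricted_two (hN : IsOpen (N : Set (absoluteGaloisGroup K))) (hN' : IsOpen (N' : Set (absoluteGaloisGroup K))) (h : N' ≤ N)
    (hNS : ramificationSubgroup K S ≤ N) (hN'S : ramificationSubgroup K S ≤ N') (hρ : ramificationSubgroup K S ≤ ContinuousRep.ker ρ) [Fintype (absoluteGaloisGroup K ⧸ N')]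
    [Fintype (GaloisGroupUnramifiedOutside K S ⧸ N'.map (toUnramifiedQuot K S))]
    [Fintype (↥(N.map (toUnramifiedQuot K S)) ⧸ (N'.map (toUnramifiedQuot K S)).subgroupOf (N.map (toUnramifiedQuot K S)))]
    {y : continuousCohomology 2 (subgroupRep (ρ.quotientInvariants (ramificationSubgroup K S)).toTopRep
        (N'.map (toUnramifiedQuot K S)))}
    (hy : y ∈ layerShaRestricted S ρ N' 2) :
    haveI : TotallyDisconnectedSpace (GaloisGroupUnramifiedOutside K S) :=
      Literature.GroupTheory.ProfiniteSubquotients.totallyDisconnectedSpace_quotient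
        (ramificationSubgroup K S) (ramificationSubgroup_isClosed K S)
    haveI : IsClosed ((N.map (toUnramifiedQuot K S) : Subgroup (GaloisGroupUnramifiedOutside K S)) :
        Set (GaloisGroupUnramifiedOutside K S)) := Subgroup.isClosed_of_isOpen _ (isOpen_map_toUnramifiedQuot S N hN)
    haveI : IsClosed ((N'.map (toUnramifiedQuot K S) : Subgroup (GaloisGroupUnramifiedOutside K S)) :
        Set (GaloisGroupUnramifiedOutside K S)) := Subgroup.isClosed_of_isOpen _ (isOpen_map_toUnramifiedQuot S N' hN')
    relCor (N.map (toUnramifiedQuot K S)) (N'.map (toUnramifiedQuot K S)) (ρ.quotientInvariants (ramificationSubgroup K S))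
        (Subgroup.map_mono h) 2 y ∈ layerShaRestricted S ρ N 2 := by
  set c := (shaRestrictedLayerEquiv_two S ρ N' hN' hN'S hρ).symm ⟨y, hy⟩ with hc
  have hyc : y = layerShapiroEquiv S ρ N' hN' 2 (restrictedCohomologyEquiv S ρ N' hN' hN'S hρ 2
      (c : restrictedCohomology (ρ.coindOpen N' hN') S 2)) := by
    rw [← coe_shaRestrictedLayerEquiv_two, hc, AddEquiv.apply_symm_apply]
  have hmem := DiscreteGaloisModule.map_mem_shaRestricted (ρ := ρ.coindOpen N' hN') (ρ' := ρ.coindOpen N hN)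
    (coindFinSum ρ.toTopRep h) S 2 c.2
  have key := layerShapiroEquiv_transport_coindFinSum S ρ N N' hN hN' h hNS hN'S hρ 2
    (c : restrictedCohomology (ρ.coindOpen N' hN') S 2)
  have hval := coe_shaRestrictedLayerEquiv_two S ρ N hN hNS hρ ⟨_, hmem⟩
  rw [hyc, ← key, ← hval]
  exact (shaRestrictedLayerEquiv_two S ρ N hN hNS hρ ⟨_, hmem⟩).2

/-- **Change of coefficients preserves `Ш¹_S`**: for an equivariant `F : M → M′`, `H¹(N̄, F^{N_S})` maps `Ш¹_S(L, M)` into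
`Ш¹_S(L, M′)` (under the transport: `H¹(G_S, Maps(F))`). [cite: NeukirchSchmidtWingberg2008, I §6 (1.6.4)–(1.6.5)] [cite: MilneADT2006, I §4 (p. 56)] -/
theorem cohomologyMap_mem_layerShaRestricted_one (hN : IsOpen (N : Set (absoluteGaloisGroup K))) (hNS : ramificationSubgroup K S ≤ N)
    (hρ : ramificationSubgroup K S ≤ ContinuousRep.ker ρ) (hρ' : ramificationSubgroup K S ≤ ContinuousRep.ker ρ') (F : ρ.toTopRep ⟶ ρ'.toTopRep)
    {z : continuousCohomology 1 (subgroupRep (ρ.quotientInvariants (ramificationSubgroup K S)).toTopRep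
        (N.map (toUnramifiedQuot K S)))}
    (hz : z ∈ layerShaRestricted S ρ N 1) :
    (cohomologyMap (subgroupRepMap (ContinuousRep.invariantsHom (N := ramificationSubgroup K S) F)
        (N.map (toUnramifiedQuot K S))) 1).hom z ∈ layerShaRestricted S ρ' N 1 := by
  set c := (shaRestrictedLayerEquiv_one S ρ N hN hNS hρ).symm ⟨z, hz⟩ with hc
  have hzc : z = layerShapiroEquiv S ρ N hN 1 (restrictedCohomologyEquiv S ρ N hN hNS hρ 1
      (c : restrictedCohomology (ρ.coindOpen N hN) S 1)) := by
    rw [← coe_shaRestrictedLayerEquiv_one, hc, AddEquiv.apply_symm_apply]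
  have hmem := DiscreteGaloisModule.map_mem_shaRestricted (ρ := ρ.coindOpen N hN) (ρ' := ρ'.coindOpen N hN)
    (coindFinMap F N) S 1 c.2
  have key := layerShapiroEquiv_transport_coindFinMap S ρ ρ' N hN hNS hρ hρ' F 1
    (c : restrictedCohomology (ρ.coindOpen N hN) S 1)
  have hval := coe_shaRestrictedLayerEquiv_one S ρ' N hN hNS hρ' ⟨_, hmem⟩
  have goal' := (shaRestrictedLayerEquiv_one S ρ' N hN hNS hρ' ⟨_, hmem⟩).2
  rw [hval, key] at goal'
  rw [hzc]
  exact goal'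

/-- **Change of coefficients preserves `Ш²_S`** (as `…_one`). [cite: NeukirchSchmidtWingberg2008, I §6 (1.6.4)–(1.6.5)] [cite: MilneADT2006, I §4 (p. 56)] -/
theorem cohomologyMap_mem_layerShaRestricted_two (hN : IsOpen (N : Set (absoluteGaloisGroup K))) (hNS : ramificationSubgroup K S ≤ N)
    (hρ : ramificationSubgroup K S ≤ ContinuousRep.ker ρ) (hρ' : ramificationSubgroup K S ≤ ContinuousRep.ker ρ') (F : ρ.toTopRep ⟶ ρ'.toTopRep)
    {z : continuousCohomology 2 (subgroupRep (ρ.quotientInvariants (ramificationSubgroup K S)).toTopRep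
        (N.map (toUnramifiedQuot K S)))}
    (hz : z ∈ layerShaRestricted S ρ N 2) :
    (cohomologyMap (subgroupRepMap (ContinuousRep.invariantsHom (N := ramificationSubgroup K S) F)
        (N.map (toUnramifiedQuot K S))) 2).hom z ∈ layerShaRestricted S ρ' N 2 := by
  set c := (shaRestrictedLayerEquiv_two S ρ N hN hNS hρ).symm ⟨z, hz⟩ with hc
  have hzc : z = layerShapiroEquiv S ρ N hN 2 (restrictedCohomologyEquiv S ρ N hN hNS hρ 2
      (c : restrictedCohomology (ρ.coindOpen N hN) S 2)) := by
    rw [← coe_shaRestrictedLayerEquiv_two, hc, AddEquiv.apply_symm_apply]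
  have hmem := DiscreteGaloisModule.map_mem_shaRestricted (ρ := ρ.coindOpen N hN) (ρ' := ρ'.coindOpen N hN)
    (coindFinMap F N) S 2 c.2
  have key := layerShapiroEquiv_transport_coindFinMap S ρ ρ' N hN hNS hρ hρ' F 2
    (c : restrictedCohomology (ρ.coindOpen N hN) S 2)
  have hval := coe_shaRestrictedLayerEquiv_two S ρ' N hN hNS hρ' ⟨_, hmem⟩
  have goal' := (shaRestrictedLayerEquiv_two S ρ' N hN hNS hρ' ⟨_, hmem⟩).2
  rw [hval, key] at goal'
  rw [hzc]
  exact goal'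

end Transport

end ShaLayer

end Literature.NumberTheory.GaloisCohomology

end
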